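import Mathlib
import HarnessLib
import Summits.HubbardSuperconductivity.HubbardSuperconductivity.Theorems.KLProgrammeKLRegimeSplitTwoLegThresholdsExplicit
import Summits.HubbardSuperconductivity.HubbardSuperconductivity.Theorems.KLProgrammeKLRegimeSplitTwoLegCoreTZeroFromExports
import Summits.HubbardSuperconductivity.HubbardSuperconductivity.Theorems.KLProgrammeKLRegimeSplitTwoLegPieceFnBounds

/-!
# Route `KLProgramme` — gen-5 ENGINE child 19918, stubs `stub_twoLeg_step` / `stub_twoLeg_scale0`: the V14 slot core `TwoLegCoreT` assembled from the
# expansion's exports UNDER THE NAMED THRESHOLDS `c ≤ klCurveC3 R`, `U ≤ klCurveU0 R` — invocable inside the stubs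
# (`klEngC₃3 P R ≤ klCurveC3 R`, `klEngU₀3 P R c ≤ klCurveU0 R`, `…TwoLegThresholdsExplicit`)

Cell `gate-hubbard-kl`, seat p1b (g6).  The `∃ c₃ U₀`-keyed assemblies `twoLegCoreT_succ_of_position_exports` / `twoLegCoreT_zero_of_exports`
(`…TwoLegCoreTFromExports`, `…CoreTZeroFromExports`) cannot be applied under the 19918 skeleton's binders; these can:
* **`twoLegCoreT_succ_of_position_exports_explicit`** — `TwoLegCoreT hist G P Q R β U μ K (n+1)` from: increment position moments `Mˢ_{k≤4}` + cutoff
  numerals `X` + the β-free fit into `twoLegBar G Q U j (n+1)` (`j ≤ 2`, order-resolved); the pinned `L¹` frame-Lipschitz modulus `ρ_fr` of the increment kernel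
  + fit `2ρ_fr + 2Mˢ₁/klCurveD ≤ lipBar G Q U (n+1)`; `Mˢ₁′, Mᵗ` of `W^{(n+1)}` with `2Mˢ₁′ ≤ cz|U|·(cDtmin(−1.2,−0.05)/2)`, `2Mᵗ ≤ cz|U|`;
* **`twoLegCoreT_zero_of_exports_explicit`** — the scale-`0` twin (`T^K = S_0^K − K` for (E3c)).
Appended: the STUB-KEYED corollaries `twoLegCoreT_succ_of_position_exports_stub` / `twoLegCoreT_zero_of_exports_stub` in the 19918 skeleton's binders
(`R.WF2`, `c ≤ klEngC₃3 P R`, `U ≤ klEngU₀3 P R c`, `G := klEngGeo3`, `Q := klEngQ3 P R`).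
Proofs only; nothing about the model is asserted.  References: BGM 2006 §2.4 [cite: BenfattoGiulianiMastropietro2006].
-/

noncomputable section

namespace Summit.HubbardSuperconductivity.HubbardSuperconductivity.Theorems.KLRegimeSplit

set_option linter.dupNamespace false -- summit = problem name (single-conjunct summit), D-0017

open Real Finset
open Literature.MathematicalPhysics.QuantumLattice Literature.MathematicalPhysics.QuantumLattice.BandSectorCounting
open Literature.Probability.LatticeModels
open Summit.HubbardSuperconductivity.HubbardSuperconductivity.Theorems.DispersionFlow
open Summit.HubbardSuperconductivity.HubbardSuperconductivity.Theorems.PerturbedFermiCurve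
open Summit.HubbardSuperconductivity.HubbardSuperconductivity.Theorems.KLProgrammeLegKernels
open Summit.HubbardSuperconductivity.HubbardSuperconductivity.Theorems.TwoLegFourier
open Summit.HubbardSuperconductivity.HubbardSuperconductivity.Theorems.EngineV8

variable {L M : ℕ} [NeZero L] [NeZero M]

/-- **`TwoLegCoreT hist … K (n+1)` from position-space exports, NAMED thresholds** (see the module docstring for the export list). -/
theorem twoLegCoreT_succ_of_position_exports_explicit {R : RenConsts} (hR : ∀ j, 0 ≤ R.Gfr j) {c : ℝ} (hc : 0 < c)
    (hcle : c ≤ klCurveC3 R) {U : ℝ} (hU : 0 < U) (hUle : U ≤ klCurveU0 R) {β : ℝ} (hβmin : klBetaMin ≤ β)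
    (hβc : β ≤ Real.exp (c / U ^ 2)) {μ : ℝ} (hμ : μ ∈ klWindowC) {K : TrigPolyC4v} (hK : FrameOK R U (nScales β) μ K)
    (hist : TrigPolyC4v → ℕ → Prop) (G : GeoConsts) (P : SplitConsts) (Q : EngConsts) (n : ℕ)
    -- (E3a-T1) exports
    {Ms : ℕ → ℝ} {X : ℝ}
    (hMs : ∀ k ≤ 4, ∀ (σ : Fin 2) (x₀ : SpaceTimeIdx L M), imagTimeWeight β M *
      ∑ x ∈ (univ : Finset (Fin 2 → SpaceTimeIdx L M)).filter (fun x => x 0 = x₀),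
        (1 + ((((x 1).2 - (x 0).2) 0).valMinAbs.natAbs : ℝ) + ((((x 1).2 - (x 0).2) 1).valMinAbs.natAbs : ℝ)) ^ k *
          ‖sectorisedKernel L M β (trivialMultiplier L M) (klEffectiveAction L M β U μ K klE0 (n + 1)) 2
              (![((0, σ), 0), ((0, σ), 1)] : Fin 2 → SectorLeg 1) x -
            sectorisedKernel L M β (trivialMultiplier L M) (klEffectiveAction L M β U μ K klE0 n) 2
              (![((0, σ), 0), ((0, σ), 1)] : Fin 2 → SectorLeg 1) x‖ ≤ Ms k)
    (hX : ∀ l ≤ 2, ∀ x : ℝ, ‖iteratedFDeriv ℝ l salmhoferCutoff x‖ ≤ X)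
    (hfitS : ∀ j ≤ 2, (if j = 0 then 2 * Ms 0 else 0) +
      (j.factorial : ℝ) ^ 2 * (2 * j.factorial * X * 200 ^ j) *
        (if j = 0 then 2 * (2 * Ms 0) else (2 * π + 1) * (2 * Ms 1 * klCurveD1) +
          (if j = 2 then 2 * Ms 2 * klCurveD1 ^ 2 + 2 * Ms 1 * klCurveD2 else 0)) *
        (4 + max 1 (((j - 1).factorial : ℝ) / (8 / 5))) ^ j ≤ twoLegBar G Q U j (n + 1))
    -- (E3c-T) export: the pinned L¹ frame-Lipschitz modulus of the increment kernel
    {ρfr : ℝ}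
    (hρ : ∀ K' : TrigPolyC4v, FrameOK R U (klTempScaleIdx β klE0) μ K' → (∀ j < n + 1, hist K' j) →
      ∀ (σ : Fin 2) (x₀ : SpaceTimeIdx L M), imagTimeWeight β M *
        ∑ x ∈ (univ : Finset (Fin 2 → SpaceTimeIdx L M)).filter (fun x => x 0 = x₀),
          (1 + ((((x 1).2 - (x 0).2) 0).valMinAbs.natAbs : ℝ) + ((((x 1).2 - (x 0).2) 1).valMinAbs.natAbs : ℝ)) ^ 0 *
            ‖sectorisedKernel L M β (trivialMultiplier L M)
                ((klEffectiveAction L M β U μ K klE0 (n + 1) - klEffectiveAction L M β U μ K klE0 n) -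
                  (klEffectiveAction L M β U μ K' klE0 (n + 1) - klEffectiveAction L M β U μ K' klE0 n)) 2
                (![((0, σ), 0), ((0, σ), 1)] : Fin 2 → SectorLeg 1) x‖ ≤ ρfr * frameDist K K')
    (hfitL : 2 * ρfr + 2 * Ms 1 / klCurveD ≤ lipBar G Q U (n + 1))
    -- (E3d/e) exports at scale `n + 1`
    {Ms₁ Mt : ℝ} (hMs₁0 : 0 ≤ Ms₁)
    (hMs₁ : ∀ (σ : Fin 2) (x₀ : SpaceTimeIdx L M), imagTimeWeight β M *
      ∑ x ∈ (univ : Finset (Fin 2 → SpaceTimeIdx L M)).filter (fun x => x 0 = x₀),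
        (1 + ((((x 1).2 - (x 0).2) 0).valMinAbs.natAbs : ℝ) + ((((x 1).2 - (x 0).2) 1).valMinAbs.natAbs : ℝ)) ^ 1 *
          ‖sectorisedKernel L M β (trivialMultiplier L M) (klEffectiveAction L M β U μ K klE0 (n + 1)) 2
            (![((0, σ), 0), ((0, σ), 1)] : Fin 2 → SectorLeg 1) x‖ ≤ Ms₁)
    (hMt : ∀ (σ : Fin 2) (x₀ : SpaceTimeIdx L M), imagTimeWeight β M *
      ∑ x ∈ (univ : Finset (Fin 2 → SpaceTimeIdx L M)).filter (fun x => x 0 = x₀),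
        imagTimeWeight β M * (circDist (2 * M) (x 0).1.val (x 1).1.val : ℝ) *
          ‖sectorisedKernel L M β (trivialMultiplier L M) (klEffectiveAction L M β U μ K klE0 (n + 1)) 2
            (![((0, σ), 0), ((0, σ), 1)] : Fin 2 → SectorLeg 1) x‖ ≤ Mt)
    (hfit1 : 2 * Ms₁ ≤ R.cz * |U| * (cDtmin (-1.2) (-0.05) / 2)) (hfit2 : 2 * Mt ≤ R.cz * |U|) :
    TwoLegCoreT L M hist G P Q R β U μ K (n + 1) := by
  have ha : (-4 : ℝ) < -1.1 := by norm_num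
  have hab : (-1.1 : ℝ) ≤ -0.1 := by norm_num
  have hb : (-0.1 : ℝ) < 0 := by norm_num
  obtain ⟨hAf, hA20, hADt, -, ⟨hlo, hhi⟩, -, -⟩ := frame_sizes_of_frameOK_explicit hR hc hcle hU hUle hβmin hβc hμ hK
  have hβ : 0 < β := lt_of_lt_of_le (by unfold klBetaMin; norm_num) hβmin
  have hνC : ∀ k : ℕ, ContDiff ℝ 4 (klLocalPart L M β U μ K k) := fun k =>
    contDiff_klLocalPart (bandBounds ha hab hb) hAf hADt hlo hhi L M β U k
  have hMs10 : 0 ≤ Ms 1 := by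
    refine le_trans (mul_nonneg (imagTimeWeight_nonneg hβ.le M) (sum_nonneg fun x _ => ?_)) (hMs 1 (by norm_num) 0 0)
    positivity
  refine ⟨⟨?_, fun j hj q => ?_⟩, ?_, ?_⟩
  · -- `ContDiff ℝ 4 (onM ℓ_{n+1}(K.eval))`
    have hP := klTwoLegPieceFn_eval_succ (L := L) (M := M) β U μ K n (hνC (n + 1)).continuous (hνC n).continuous
    have hδ : ContDiff ℝ (4 : ℕ∞) (fun θ => klLocalPart L M β U μ K (n + 1) θ - klLocalPart L M β U μ K n θ) := by
      exact_mod_cast (hνC (n + 1)).sub (hνC n)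
    have hper : Function.Periodic (fun θ => klLocalPart L M β U μ K (n + 1) θ - klLocalPart L M β U μ K n θ) (2 * π) := fun θ => by
      simp only [klLocalPart_periodic β U μ K (n + 1) θ, klLocalPart_periodic β U μ K n θ]
    exact_mod_cast contDiff_onM_piece hP hδ hper hμ
  · exact (twoLegPieceV13_tier1_size_le_of_position_moments (L := L) (M := M) hR hc hcle hU hUle hβmin hβc hμ hK n hMs hj
      (fun l hl x => hX l (hl.trans hj) x) q).trans (hfitS j hj)
  · refine frameLipschitzFnT_succ_of_increment_responses_explicit (L := L) (M := M) hR hc hcle hU hUle hβmin hβc hμ hK hist G Q n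
      (bΔ := 2 * Ms 1) (ρΔ := 2 * ρfr) (by positivity)
      (norm_fderiv_increment_le_of_position_moment hβ U μ K n (hMs 1 (by norm_num))) (fun K' hK' hh θ => ?_) (by linarith)
    have h := abs_increment_eval_sub_le_of_position_moment (L := L) (M := M) hβ U μ K K' n (hρ K' hK' hh) (klFermiPoint μ K' θ)
    linarith
  · exact twoLegSlopes_of_position_moments_explicit (L := L) (M := M) hR hc hcle hU hUle hβmin hβc hμ hK (n + 1) hMs₁0 hMs₁ hMt hfit1 hfit2

/-- **`TwoLegCoreT hist … K 0` from the scale-`0` exports, NAMED thresholds** (scale-`0` moments `Mˢ k` of `W^{(0)}`, numerals `X`, fit with the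
β-free frame size `A`; `b₀, ρ₀` of `T^K = S_0^K − K` with `ρ₀ + b₀/klCurveD ≤ lipBar G Q U 0`; `Mˢ₁, Mᵗ` of `W^{(0)}`). -/
theorem twoLegCoreT_zero_of_exports_explicit {R : RenConsts} (hR : ∀ j, 0 ≤ R.Gfr j) {c : ℝ} (hc : 0 < c)
    (hcle : c ≤ klCurveC3 R) {U : ℝ} (hU : 0 < U) (hUle : U ≤ klCurveU0 R) {β : ℝ} (hβmin : klBetaMin ≤ β)
    (hβc : β ≤ Real.exp (c / U ^ 2)) {μ : ℝ} (hμ : μ ∈ klWindowC) {K : TrigPolyC4v} (hK : FrameOK R U (nScales β) μ K)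
    (hist : TrigPolyC4v → ℕ → Prop) (G : GeoConsts) (P : SplitConsts) (Q : EngConsts)
    {Ms : ℕ → ℝ} {X : ℝ}
    (hMs : ∀ k ≤ 4, ∀ (σ : Fin 2) (x₀ : SpaceTimeIdx L M), imagTimeWeight β M *
      ∑ x ∈ (univ : Finset (Fin 2 → SpaceTimeIdx L M)).filter (fun x => x 0 = x₀),
        (1 + ((((x 1).2 - (x 0).2) 0).valMinAbs.natAbs : ℝ) + ((((x 1).2 - (x 0).2) 1).valMinAbs.natAbs : ℝ)) ^ k *
          ‖sectorisedKernel L M β (trivialMultiplier L M) (klEffectiveAction L M β U μ K klE0 0) 2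
            (![((0, σ), 0), ((0, σ), 1)] : Fin 2 → SectorLeg 1) x‖ ≤ Ms k)
    (hX : ∀ l ≤ 2, ∀ x : ℝ, ‖iteratedFDeriv ℝ l salmhoferCutoff x‖ ≤ X)
    (hfitS : ∀ j ≤ 2, (if j = 0 then 2 * Ms 0 + (2 * R.Gfr 0 * |U| + 2 * R.Gfr 1 * U ^ 2 + R.Gfr 2 * (c / Real.log 4)) else 0) +
      (j.factorial : ℝ) ^ 2 * (2 * j.factorial * X * 200 ^ j) *
        (if j = 0 then 2 * (2 * Ms 0 + (2 * R.Gfr 0 * |U| + 2 * R.Gfr 1 * U ^ 2 + R.Gfr 2 * (c / Real.log 4))) else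
          (2 * π + 1) * ((2 * Ms 1 + (2 * R.Gfr 0 * |U| + 2 * R.Gfr 1 * U ^ 2 + R.Gfr 2 * (c / Real.log 4))) * klCurveD1) +
            (if j = 2 then (2 * Ms 2 + (2 * R.Gfr 0 * |U| + 2 * R.Gfr 1 * U ^ 2 + R.Gfr 2 * (c / Real.log 4))) * klCurveD1 ^ 2 +
              (2 * Ms 1 + (2 * R.Gfr 0 * |U| + 2 * R.Gfr 1 * U ^ 2 + R.Gfr 2 * (c / Real.log 4))) * klCurveD2 else 0)) *
        (4 + max 1 (((j - 1).factorial : ℝ) / (8 / 5))) ^ j ≤ twoLegBar G Q U j 0)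
    {b₀ ρ₀ : ℝ} (hb₀ : 0 ≤ b₀)
    (hg₀ : ∀ q : Momentum, ‖fderiv ℝ (fun q : Momentum =>
      evalM (symInterp L (klLocSelfEnergyRe L M β U μ K 0)) q - evalM K q) q‖ ≤ b₀)
    (hr₀ : ∀ K' : TrigPolyC4v, FrameOK R U (klTempScaleIdx β klE0) μ K' → ∀ θ : ℝ,
      |((symInterp L (klLocSelfEnergyRe L M β U μ K 0)).eval (klFermiPoint μ K' θ) - K.eval (klFermiPoint μ K' θ)) -
        ((symInterp L (klLocSelfEnergyRe L M β U μ K' 0)).eval (klFermiPoint μ K' θ) - K'.eval (klFermiPoint μ K' θ))| ≤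
        ρ₀ * frameDist K K')
    (hfitL : ρ₀ + b₀ / klCurveD ≤ lipBar G Q U 0)
    {Ms₁ Mt : ℝ} (hMs₁0 : 0 ≤ Ms₁)
    (hMs₁ : ∀ (σ : Fin 2) (x₀ : SpaceTimeIdx L M), imagTimeWeight β M *
      ∑ x ∈ (univ : Finset (Fin 2 → SpaceTimeIdx L M)).filter (fun x => x 0 = x₀),
        (1 + ((((x 1).2 - (x 0).2) 0).valMinAbs.natAbs : ℝ) + ((((x 1).2 - (x 0).2) 1).valMinAbs.natAbs : ℝ)) ^ 1 *
          ‖sectorisedKernel L M β (trivialMultiplier L M) (klEffectiveAction L M β U μ K klE0 0) 2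
            (![((0, σ), 0), ((0, σ), 1)] : Fin 2 → SectorLeg 1) x‖ ≤ Ms₁)
    (hMt : ∀ (σ : Fin 2) (x₀ : SpaceTimeIdx L M), imagTimeWeight β M *
      ∑ x ∈ (univ : Finset (Fin 2 → SpaceTimeIdx L M)).filter (fun x => x 0 = x₀),
        imagTimeWeight β M * (circDist (2 * M) (x 0).1.val (x 1).1.val : ℝ) *
          ‖sectorisedKernel L M β (trivialMultiplier L M) (klEffectiveAction L M β U μ K klE0 0) 2
            (![((0, σ), 0), ((0, σ), 1)] : Fin 2 → SectorLeg 1) x‖ ≤ Mt)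
    (hfit1 : 2 * Ms₁ ≤ R.cz * |U| * (cDtmin (-1.2) (-0.05) / 2)) (hfit2 : 2 * Mt ≤ R.cz * |U|) :
    TwoLegCoreT L M hist G P Q R β U μ K 0 := by
  have ha : (-4 : ℝ) < -1.1 := by norm_num
  have hab : (-1.1 : ℝ) ≤ -0.1 := by norm_num
  have hb : (-0.1 : ℝ) < 0 := by norm_num
  obtain ⟨hAf, hA20, hADt, -, ⟨hlo, hhi⟩, -, -⟩ := frame_sizes_of_frameOK_explicit hR hc hcle hU hUle hβmin hβc hμ hK
  have h0 : ContDiff ℝ 4 (klLocalPart L M β U μ K 0) := contDiff_klLocalPart (bandBounds ha hab hb) hAf hADt hlo hhi L M β U 0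
  have hKc : ContDiff ℝ 4 (fun θ => K.eval (klFermiPoint μ K θ)) := contDiff_eval_klFermiPoint (bandBounds ha hab hb) hAf hADt hlo hhi K
  refine ⟨⟨?_, fun j hj q => ?_⟩, ?_, ?_⟩
  · have hP := klTwoLegPieceFn_eval_zero (L := L) (M := M) β U μ K h0.continuous hKc.continuous
    have hδ : ContDiff ℝ (4 : ℕ∞) (fun θ => klLocalPart L M β U μ K 0 θ - K.eval (klFermiPoint μ K θ)) := by
      exact_mod_cast h0.sub hKc
    have hper : Function.Periodic (fun θ => klLocalPart L M β U μ K 0 θ - K.eval (klFermiPoint μ K θ)) (2 * π) := fun θ => by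
      simp only [klLocalPart_periodic β U μ K 0 θ, frameOnCurve_periodic μ K θ]
    exact_mod_cast contDiff_onM_piece hP hδ hper hμ
  · exact (twoLegPieceFn_eval_zero_tier1_size_le (L := L) (M := M) hR hc hcle hU hUle hβmin hβc hμ hK hMs hj
      (fun l hl x => hX l (hl.trans hj) x) q).trans (hfitS j hj)
  · exact frameLipschitzFnT_zero_of_responses_explicit (L := L) (M := M) hR hc hcle hU hUle hβmin hβc hμ hK hist G Q hb₀ hg₀ hr₀ hfitL
  · exact twoLegSlopes_of_position_moments_explicit (L := L) (M := M) hR hc hcle hU hUle hβmin hβc hμ hK 0 hMs₁0 hMs₁ hMt hfit1 hfit2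


/-! ## Stub-keyed corollaries (the 19918 skeleton's binders) -/

/-- **Stub-keyed** (`stub_twoLeg_step`'s binders: `R.WF2`, `c ≤ klEngC₃3 P R`, `U ≤ klEngU₀3 P R c`, `G := klEngGeo3`, `Q := klEngQ3 P R`):
`TwoLegCoreT hist klEngGeo3 P (klEngQ3 P R) R β U μ K (n+1)` from the position-space exports of `twoLegCoreT_succ_of_position_exports_explicit`. -/
theorem twoLegCoreT_succ_of_position_exports_stub (P : SplitConsts) {R : RenConsts} (hRW : R.WF2) {c : ℝ} (hc : 0 < c)
    (hcle : c ≤ klEngC₃3 P R) {U : ℝ} (hU : 0 < U) (hUle : U ≤ klEngU₀3 P R c) {β : ℝ} (hβmin : klBetaMin ≤ β)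
    (hβc : β ≤ Real.exp (c / U ^ 2)) {μ : ℝ} (hμ : μ ∈ klWindowC) {K : TrigPolyC4v} (hK : FrameOK R U (nScales β) μ K)
    (hist : TrigPolyC4v → ℕ → Prop) (n : ℕ)
    -- (E3a-T1) exports
    {Ms : ℕ → ℝ} {X : ℝ}
    (hMs : ∀ k ≤ 4, ∀ (σ : Fin 2) (x₀ : SpaceTimeIdx L M), imagTimeWeight β M *
      ∑ x ∈ (univ : Finset (Fin 2 → SpaceTimeIdx L M)).filter (fun x => x 0 = x₀),
        (1 + ((((x 1).2 - (x 0).2) 0).valMinAbs.natAbs : ℝ) + ((((x 1).2 - (x 0).2) 1).valMinAbs.natAbs : ℝ)) ^ k *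
          ‖sectorisedKernel L M β (trivialMultiplier L M) (klEffectiveAction L M β U μ K klE0 (n + 1)) 2
              (![((0, σ), 0), ((0, σ), 1)] : Fin 2 → SectorLeg 1) x -
            sectorisedKernel L M β (trivialMultiplier L M) (klEffectiveAction L M β U μ K klE0 n) 2
              (![((0, σ), 0), ((0, σ), 1)] : Fin 2 → SectorLeg 1) x‖ ≤ Ms k)
    (hX : ∀ l ≤ 2, ∀ x : ℝ, ‖iteratedFDeriv ℝ l salmhoferCutoff x‖ ≤ X)
    (hfitS : ∀ j ≤ 2, (if j = 0 then 2 * Ms 0 else 0) +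
      (j.factorial : ℝ) ^ 2 * (2 * j.factorial * X * 200 ^ j) *
        (if j = 0 then 2 * (2 * Ms 0) else (2 * π + 1) * (2 * Ms 1 * klCurveD1) +
          (if j = 2 then 2 * Ms 2 * klCurveD1 ^ 2 + 2 * Ms 1 * klCurveD2 else 0)) *
        (4 + max 1 (((j - 1).factorial : ℝ) / (8 / 5))) ^ j ≤ twoLegBar klEngGeo3 (klEngQ3 P R) U j (n + 1))
    -- (E3c-T) export: the pinned L¹ frame-Lipschitz modulus of the increment kernel
    {ρfr : ℝ}
    (hρ : ∀ K' : TrigPolyC4v, FrameOK R U (klTempScaleIdx β klE0) μ K' → (∀ j < n + 1, hist K' j) →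
      ∀ (σ : Fin 2) (x₀ : SpaceTimeIdx L M), imagTimeWeight β M *
        ∑ x ∈ (univ : Finset (Fin 2 → SpaceTimeIdx L M)).filter (fun x => x 0 = x₀),
          (1 + ((((x 1).2 - (x 0).2) 0).valMinAbs.natAbs : ℝ) + ((((x 1).2 - (x 0).2) 1).valMinAbs.natAbs : ℝ)) ^ 0 *
            ‖sectorisedKernel L M β (trivialMultiplier L M)
                ((klEffectiveAction L M β U μ K klE0 (n + 1) - klEffectiveAction L M β U μ K klE0 n) -
                  (klEffectiveAction L M β U μ K' klE0 (n + 1) - klEffectiveAction L M β U μ K' klE0 n)) 2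
                (![((0, σ), 0), ((0, σ), 1)] : Fin 2 → SectorLeg 1) x‖ ≤ ρfr * frameDist K K')
    (hfitL : 2 * ρfr + 2 * Ms 1 / klCurveD ≤ lipBar klEngGeo3 (klEngQ3 P R) U (n + 1))
    -- (E3d/e) exports at scale `n + 1`
    {Ms₁ Mt : ℝ} (hMs₁0 : 0 ≤ Ms₁)
    (hMs₁ : ∀ (σ : Fin 2) (x₀ : SpaceTimeIdx L M), imagTimeWeight β M *
      ∑ x ∈ (univ : Finset (Fin 2 → SpaceTimeIdx L M)).filter (fun x => x 0 = x₀),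
        (1 + ((((x 1).2 - (x 0).2) 0).valMinAbs.natAbs : ℝ) + ((((x 1).2 - (x 0).2) 1).valMinAbs.natAbs : ℝ)) ^ 1 *
          ‖sectorisedKernel L M β (trivialMultiplier L M) (klEffectiveAction L M β U μ K klE0 (n + 1)) 2
            (![((0, σ), 0), ((0, σ), 1)] : Fin 2 → SectorLeg 1) x‖ ≤ Ms₁)
    (hMt : ∀ (σ : Fin 2) (x₀ : SpaceTimeIdx L M), imagTimeWeight β M *
      ∑ x ∈ (univ : Finset (Fin 2 → SpaceTimeIdx L M)).filter (fun x => x 0 = x₀),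
        imagTimeWeight β M * (circDist (2 * M) (x 0).1.val (x 1).1.val : ℝ) *
          ‖sectorisedKernel L M β (trivialMultiplier L M) (klEffectiveAction L M β U μ K klE0 (n + 1)) 2
            (![((0, σ), 0), ((0, σ), 1)] : Fin 2 → SectorLeg 1) x‖ ≤ Mt)
    (hfit1 : 2 * Ms₁ ≤ R.cz * |U| * (cDtmin (-1.2) (-0.05) / 2)) (hfit2 : 2 * Mt ≤ R.cz * |U|) :
    TwoLegCoreT L M hist klEngGeo3 P (klEngQ3 P R) R β U μ K (n + 1) :=
  have hR : ∀ j, 0 ≤ R.Gfr j := hRW.1.2.2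
  twoLegCoreT_succ_of_position_exports_explicit (L := L) (M := M) hR hc (hcle.trans (klEngC₃3_le_klCurveC3 P hR)) hU
    (hUle.trans (klEngU₀3_le_klCurveU0 P hR c)) hβmin hβc hμ hK hist klEngGeo3 P (klEngQ3 P R) n hMs hX hfitS hρ hfitL hMs₁0 hMs₁ hMt
    hfit1 hfit2

/-- **Stub-keyed** (`stub_twoLeg_scale0`'s binders): `TwoLegCoreT hist klEngGeo3 P (klEngQ3 P R) R β U μ K 0` from the scale-`0` exports of
`twoLegCoreT_zero_of_exports_explicit`. -/
theorem twoLegCoreT_zero_of_exports_stub (P : SplitConsts) {R : RenConsts} (hRW : R.WF2) {c : ℝ} (hc : 0 < c)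
    (hcle : c ≤ klEngC₃3 P R) {U : ℝ} (hU : 0 < U) (hUle : U ≤ klEngU₀3 P R c) {β : ℝ} (hβmin : klBetaMin ≤ β)
    (hβc : β ≤ Real.exp (c / U ^ 2)) {μ : ℝ} (hμ : μ ∈ klWindowC) {K : TrigPolyC4v} (hK : FrameOK R U (nScales β) μ K)
    (hist : TrigPolyC4v → ℕ → Prop)
    {Ms : ℕ → ℝ} {X : ℝ}
    (hMs : ∀ k ≤ 4, ∀ (σ : Fin 2) (x₀ : SpaceTimeIdx L M), imagTimeWeight β M *
      ∑ x ∈ (univ : Finset (Fin 2 → SpaceTimeIdx L M)).filter (fun x => x 0 = x₀),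
        (1 + ((((x 1).2 - (x 0).2) 0).valMinAbs.natAbs : ℝ) + ((((x 1).2 - (x 0).2) 1).valMinAbs.natAbs : ℝ)) ^ k *
          ‖sectorisedKernel L M β (trivialMultiplier L M) (klEffectiveAction L M β U μ K klE0 0) 2
            (![((0, σ), 0), ((0, σ), 1)] : Fin 2 → SectorLeg 1) x‖ ≤ Ms k)
    (hX : ∀ l ≤ 2, ∀ x : ℝ, ‖iteratedFDeriv ℝ l salmhoferCutoff x‖ ≤ X)
    (hfitS : ∀ j ≤ 2, (if j = 0 then 2 * Ms 0 + (2 * R.Gfr 0 * |U| + 2 * R.Gfr 1 * U ^ 2 + R.Gfr 2 * (c / Real.log 4)) else 0) +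
      (j.factorial : ℝ) ^ 2 * (2 * j.factorial * X * 200 ^ j) *
        (if j = 0 then 2 * (2 * Ms 0 + (2 * R.Gfr 0 * |U| + 2 * R.Gfr 1 * U ^ 2 + R.Gfr 2 * (c / Real.log 4))) else
          (2 * π + 1) * ((2 * Ms 1 + (2 * R.Gfr 0 * |U| + 2 * R.Gfr 1 * U ^ 2 + R.Gfr 2 * (c / Real.log 4))) * klCurveD1) +
            (if j = 2 then (2 * Ms 2 + (2 * R.Gfr 0 * |U| + 2 * R.Gfr 1 * U ^ 2 + R.Gfr 2 * (c / Real.log 4))) * klCurveD1 ^ 2 +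
              (2 * Ms 1 + (2 * R.Gfr 0 * |U| + 2 * R.Gfr 1 * U ^ 2 + R.Gfr 2 * (c / Real.log 4))) * klCurveD2 else 0)) *
        (4 + max 1 (((j - 1).factorial : ℝ) / (8 / 5))) ^ j ≤ twoLegBar klEngGeo3 (klEngQ3 P R) U j 0)
    {b₀ ρ₀ : ℝ} (hb₀ : 0 ≤ b₀)
    (hg₀ : ∀ q : Momentum, ‖fderiv ℝ (fun q : Momentum =>
      evalM (symInterp L (klLocSelfEnergyRe L M β U μ K 0)) q - evalM K q) q‖ ≤ b₀)
    (hr₀ : ∀ K' : TrigPolyC4v, FrameOK R U (klTempScaleIdx β klE0) μ K' → ∀ θ : ℝ,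
      |((symInterp L (klLocSelfEnergyRe L M β U μ K 0)).eval (klFermiPoint μ K' θ) - K.eval (klFermiPoint μ K' θ)) -
        ((symInterp L (klLocSelfEnergyRe L M β U μ K' 0)).eval (klFermiPoint μ K' θ) - K'.eval (klFermiPoint μ K' θ))| ≤
        ρ₀ * frameDist K K')
    (hfitL : ρ₀ + b₀ / klCurveD ≤ lipBar klEngGeo3 (klEngQ3 P R) U 0)
    {Ms₁ Mt : ℝ} (hMs₁0 : 0 ≤ Ms₁)
    (hMs₁ : ∀ (σ : Fin 2) (x₀ : SpaceTimeIdx L M), imagTimeWeight β M *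
      ∑ x ∈ (univ : Finset (Fin 2 → SpaceTimeIdx L M)).filter (fun x => x 0 = x₀),
        (1 + ((((x 1).2 - (x 0).2) 0).valMinAbs.natAbs : ℝ) + ((((x 1).2 - (x 0).2) 1).valMinAbs.natAbs : ℝ)) ^ 1 *
          ‖sectorisedKernel L M β (trivialMultiplier L M) (klEffectiveAction L M β U μ K klE0 0) 2
            (![((0, σ), 0), ((0, σ), 1)] : Fin 2 → SectorLeg 1) x‖ ≤ Ms₁)
    (hMt : ∀ (σ : Fin 2) (x₀ : SpaceTimeIdx L M), imagTimeWeight β M *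
      ∑ x ∈ (univ : Finset (Fin 2 → SpaceTimeIdx L M)).filter (fun x => x 0 = x₀),
        imagTimeWeight β M * (circDist (2 * M) (x 0).1.val (x 1).1.val : ℝ) *
          ‖sectorisedKernel L M β (trivialMultiplier L M) (klEffectiveAction L M β U μ K klE0 0) 2
            (![((0, σ), 0), ((0, σ), 1)] : Fin 2 → SectorLeg 1) x‖ ≤ Mt)
    (hfit1 : 2 * Ms₁ ≤ R.cz * |U| * (cDtmin (-1.2) (-0.05) / 2)) (hfit2 : 2 * Mt ≤ R.cz * |U|) :
    TwoLegCoreT L M hist klEngGeo3 P (klEngQ3 P R) R β U μ K 0 :=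
  have hR : ∀ j, 0 ≤ R.Gfr j := hRW.1.2.2
  twoLegCoreT_zero_of_exports_explicit (L := L) (M := M) hR hc (hcle.trans (klEngC₃3_le_klCurveC3 P hR)) hU
    (hUle.trans (klEngU₀3_le_klCurveU0 P hR c)) hβmin hβc hμ hK hist klEngGeo3 P (klEngQ3 P R) hMs hX hfitS hb₀ hg₀ hr₀ hfitL hMs₁0 hMs₁ hMt
    hfit1 hfit2

end Summit.HubbardSuperconductivity.HubbardSuperconductivity.Theorems.KLRegimeSplit

end
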